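import Summits.ValiantsHypothesis.ValiantsHypothesis.Theses.KPlusLogSqLawOctave
import Summits.ValiantsHypothesis.ValiantsHypothesis.Theorems.KPlusLogSqLawOctaveNewtonCellsSharp

/-!
**v3 (wired to the LANDED Theorems ports p607993 `…OctaveNewtonCells`, p608184 `…OctaveNewtonCellsHeight`, p609719 `…OctaveNewtonCellsSharp`)**: every
rung and kernel arrow of v2 is now an ACCEPTED Theorems declaration and is used BY NAME below; this workfile keeps only the two LAW STUBS (the line's bets,
the only sorries), the by-name arrows to the route item, and the t-free kernel constant `C ↦ C + 4` (`OctaveWeakLifting_of_sharp`, from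
`octaveCount_pencilDet_le_eight_mul`).  Sorries = 2 = stubs.  VP ≠ VNP is not moved; Ω-W / WeakLifting / TropicalB / Conjecture B stay OPEN.

v2 header (kept for the record):

# Crux `WeakLifting` (stmt-ValiantsHypothesis-19561) · octave door `OctaveWeakLifting` (Ω-W, stmt-24457) — LINE «newton-cells» (lens = control)

Ideator seat val-idea-1 (g4), D-0145 line proposal.  HONEST FRAMING: nothing here proves `OctaveWeakLifting`, `WeakLifting`,
`TropicalB`, Conjecture B or VP ≠ VNP; the law stubs below are BETS (sorried), everything else is kernel-checked composition of LANDED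
tree theorems.  VP ≠ VNP is not moved by a law candidate.

THE CONTROLLING QUANTITY.  For a real polynomial `f` let `newtonBreaks f ⊂ ℝ` be the breakpoints of its TRUE archimedean Newton
polygon `θ ↦ max_e (log₂|c_e| + e θ)` (tree: `Octave.newtonBreaks`, val-width-19561-oc1) and

  `newtonCells f := {⌊b⌋ : b ∈ newtonBreaks f} ⊂ ℤ`,   `V₁(f) := #newtonCells f`

— the number of UNIT θ-CELLS that contain a true Newton breakpoint.  It is representation-free (a function of `det F` alone, hence
immune to framing / dead classes / basis choice by construction), it quotients out FLAT VERTEX CLUSTERS (the recorded failure mode of the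
raw vertex count `#newtonBreaks`: `det((X^D+1)·I_m)` has `m+1` true vertices in ≤ 2 cells and ONE root octave), and it still charges
every octave that can hold a real root: `octaveCount f ≤ (2⌊log₂ t⌋+6)·V₁(f)` (`octaveCount_le_newtonCells`, from oc1's
`root_near_newtonBreaks` + `cellCount_proof`).

* K1 `NewtonCellLifting` (THE LAW STUB, relative form, door-shaped): under the UNSIGNED tropical row `TropRowD m K n`, every real
  symmetric `(m,K)` pencil has `V₁(det F) ≤ 2^{C(K+⌊log₂m⌋²)}·(n+1)`.  KERNEL: `NewtonBreakLifting ⇒ NewtonCellLifting ⇒ Ω-W`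
  (`newtonCellLifting_of_newtonBreakLifting`, `OctaveWeakLifting_of`, constant `C ↦ C+8`); neither converse is derivable
  (cells may hold only complex-root annuli: Ω-W ⇏ K1; flat clusters: K1 ⇏ NBL).
* K1♯ `NewtonCellLaw` (absolute form, row-free): `V₁(det F) ≤ 2^{C(K+⌊log₂m⌋²)}` for every real symmetric `(m,K)` pencil.  KERNEL:
  `NewtonCellLaw ⇒ octave K-law ⇒ VP ≠ VNP` WITHOUT `TropicalB` (`valiant_of_newtonCellLaw`, through the landed
  `OctaveGlue.octaveMatrixDescartes_of_octaveKLaw` / `valiant_of_octaveMatrixDescartes` / `octaveThetaWitness`); and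
  `NewtonCellLaw ⇒ NewtonCellLifting` trivially.  Honest dictionary: given `TropicalB`, K1 and K1♯ are equivalent up to the constant; K1♯
  alone is at least as strong as the octave form of Conjecture B.  SAME-WALL: the residue of K1/K1♯ is MASKING (true breakpoints far from
  the design need deep cancellation) — the door's own residue; the line re-prices it in a currency that (a) ignores clustering of roots AND
  of vertices, (b) is exactly computable on integer pencils (instrument), (c) has the depth-sector rung in CELL form with NO loss.
* R1 (RUNG, proved here, 0 sorry): `octaveCount_le_newtonCells` / `octaveCount_pencilDet_le_newtonCells` (Ω ≤ (2M+6)·V₁).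
* R2 (RUNG, proved here, 0 sorry): `newtonCellLifting_of_newtonBreakLifting`, `newtonCellLifting_of_newtonCellLaw`, the budget arithmetic.
* R3 (HEIGHT RUNG, proved here, 0 sorry): `card_newtonCells_le_of_height` (V₁ ≤ 2⌊√(2h)⌋+2 for coefficients in [A, A·2^h]),
  `octaveCount_le_of_height`; the PRECISION PRICE of a K1-counterexample (doubly-exponential heights) follows.

Namespace `Summit.ValiantsHypothesis.ValiantsHypothesis.Cruxes.WeakLifting.NewtonCells`; sorries = the law stubs ONLY.
-/

set_option linter.dupNamespace false
set_option autoImplicit false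

namespace Summit.ValiantsHypothesis.ValiantsHypothesis.Cruxes.WeakLifting.NewtonCells

open Polynomial Finset
open scoped BigOperators
open Summit.ValiantsHypothesis.ValiantsHypothesis.Theorems.KPlusLogSqLaw (TropRowD tropRowD_of_tropRootLawAt)
open Summit.ValiantsHypothesis.ValiantsHypothesis.Theorems.LacunarySymmetroidMatrixDescartes.TropicalCensus (TropRootLawAt)
open Summit.ValiantsHypothesis.ValiantsHypothesis.Theorems.KPlusLogSqLaw.Octave
open Summit.ValiantsHypothesis.ValiantsHypothesis.Theses.KPlusLogSqLaw (TropicalB)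

/-! ### The law stubs (BETS — the only sorries of this file; the Props are the landed `Octave.NewtonCellLifting` / `Octave.NewtonCellLaw`) -/

/-- **K1 `NewtonCellLifting`** (landed def, p607993): `TropRowD m K n ⇒ #newtonCells (det F) ≤ 2^{C(K+log²m)}·(n+1)` for symmetric letters. BET. -/
theorem stub_newtonCellLifting : NewtonCellLifting := by
  sorry

/-- **K1♯ `NewtonCellLaw`** (landed def, p607993): `#newtonCells (det F) ≤ 2^{C(K+log²m)}` absolutely. BET (TropicalB-strength in the tropical limit, critic #27). -/
theorem stub_newtonCellLaw : NewtonCellLaw := by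
  sorry

/-! ### Kernel, BY NAME from the landed ports -/

/-- the route item (stmt-ValiantsHypothesis-24457) BY NAME from K1 (landed `OctaveWeakLifting_of`, constant `C ↦ C + 8`). -/
theorem routeCrux_of (h : NewtonCellLifting) :
    Summit.ValiantsHypothesis.ValiantsHypothesis.Theses.KPlusLogSqLawOctave.OctaveWeakLifting :=
  OctaveWeakLifting_of h

/-- the skeleton's composition: the stubs give the route item. -/
theorem OctaveWeakLifting_of_stubs :
    Summit.ValiantsHypothesis.ValiantsHypothesis.Theses.KPlusLogSqLawOctave.OctaveWeakLifting :=
  routeCrux_of stub_newtonCellLifting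

/-- VP ≠ VNP ⟸ TropicalB + K1 (landed `valiant_of_tropicalB_of_newtonCellLifting`). -/
theorem valiant_of_tropicalB_of_stub (hT : TropicalB) : _root_.ValiantsHypothesis :=
  valiant_of_tropicalB_of_newtonCellLifting hT stub_newtonCellLifting

/-- VP ≠ VNP ⟸ K1♯ alone (landed `valiant_of_newtonCellLaw`). -/
theorem valiant_of_stub_sharp : _root_.ValiantsHypothesis :=
  valiant_of_newtonCellLaw stub_newtonCellLaw

/-! ### The t-free kernel constant: `C ↦ C + 4` (from R1♯ `octaveCount_pencilDet_le_eight_mul`, p609719) -/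

/-- budget arithmetic for the sharp constant: `8 · (2^{C(K+L²)}(2n+1) + 1) ≤ 2^{(C+4)(K+L²)}(n+1)` for `K ≥ 1`. [folklore] -/
theorem budget_arith_sharp (C m K n : ℕ) (hK : 1 ≤ K) :
    8 * (2 ^ (C * (K + Nat.log 2 m ^ 2)) * (2 * n + 1) + 1) ≤ 2 ^ ((C + 4) * (K + Nat.log 2 m ^ 2)) * (n + 1) := by
  set L := Nat.log 2 m with hL
  set E := K + L ^ 2 with hE
  have hE1 : 1 ≤ E := le_add_right hK
  have h16 : 16 ≤ 2 ^ (4 * E) := by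
    calc (16 : ℕ) = 2 ^ 4 := by norm_num
      _ ≤ 2 ^ (4 * E) := Nat.pow_le_pow_right (by norm_num) (by omega)
  have hpow : 2 ^ ((C + 4) * E) = 2 ^ (C * E) * 2 ^ (4 * E) := by rw [← pow_add]; ring_nf
  rw [hpow]
  have h1 : 1 ≤ 2 ^ (C * E) := Nat.one_le_two_pow
  calc 8 * (2 ^ (C * E) * (2 * n + 1) + 1) ≤ 8 * (2 ^ (C * E) * (2 * n + 1) + 2 ^ (C * E)) := by nlinarith
    _ = 2 ^ (C * E) * (8 * (2 * n + 2)) := by ring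
    _ = 2 ^ (C * E) * (16 * (n + 1)) := by ring
    _ ≤ 2 ^ (C * E) * (2 ^ (4 * E) * (n + 1)) := Nat.mul_le_mul_left _ (Nat.mul_le_mul_right _ h16)
    _ = 2 ^ (C * E) * 2 ^ (4 * E) * (n + 1) := by ring

/-- **K1 ⇒ Ω-W with the t-free constant `C ↦ C + 4`** (same proof as the landed `OctaveWeakLifting_of`, with `octaveCount_pencilDet_le_eight_mul`
in place of the format-factor R1). [this line] -/
theorem OctaveWeakLifting_of_sharp (h : NewtonCellLifting) : OctaveWeakLifting := by
  obtain ⟨C, hC⟩ := h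
  refine ⟨C + 4, fun m K n hrow d S hS => ?_⟩
  show octaveCount (pencilDet d S) ≤ _
  rcases Nat.eq_zero_or_pos K with hK0 | hKpos
  · subst hK0
    rw [octaveCount_pencilDet_zero_letters]; exact Nat.zero_le _
  · have hT : TropRowD m K (2 * n) := tropRowD_of_tropRootLawAt hrow
    have hcells := hC m K (2 * n) hT d S hS
    calc octaveCount (pencilDet d S) ≤ 8 * (newtonCells (pencilDet d S)).card := octaveCount_pencilDet_le_eight_mul d S
      _ ≤ 8 * (2 ^ (C * (K + Nat.log 2 m ^ 2)) * (2 * n + 1)) := Nat.mul_le_mul_left _ hcells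
      _ ≤ 8 * (2 ^ (C * (K + Nat.log 2 m ^ 2)) * (2 * n + 1) + 1) := by omega
      _ ≤ 2 ^ ((C + 4) * (K + Nat.log 2 m ^ 2)) * (n + 1) := budget_arith_sharp C m K n hKpos

end Summit.ValiantsHypothesis.ValiantsHypothesis.Cruxes.WeakLifting.NewtonCells
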